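import Summits.BirchSwinnertonDyer.BirchSwinnertonDyer.Theorems.BiquadraticEisensteinDescentHeegnerTwistCouplingInSupplySymbolicMonskyEvenDesignObstruction
import Summits.BirchSwinnertonDyer.BirchSwinnertonDyer.Theorems.BiquadraticEisensteinDescentHeegnerTwistCouplingInSupplySymbolicMonskyPatternFreeSymb
import Literature.Combinatorics.SimpleGraph.BinaryRankEven
import HarnessLib

set_option linter.dupNamespace false -- `Summit.BirchSwinnertonDyer.BirchSwinnertonDyer.Theorems.…` (summit = sub)
set_option autoImplicit false

/-!
# Crux `HeegnerTwistCouplingInSupply` (stmt-BirchSwinnertonDyer-21381) — KERNEL PARITY: the even virtual kernel of an even root-number-`−1`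
# base has ODD dimension; EVEN THEOREM A with the dimension hypothesis discharged

Route `BiquadraticEisensteinDescent` (cell `pub/bsd-wall`, width seat `bsd-wall-cm-bed-w3` g24; `--supports` 21381, helper). The memos
THEOREM-A-w3g22 §6b / THEOREM-B-w3g23 §5b observed numerically that `s_ev := dim 𝒦_ev` is odd for every even root-number-`−1` base (μ := number
of base primes `≡ 3 (mod 4)` odd) and USED it to define `τ₀^{ev} := (s_ev + 1)/2`; EVEN THEOREM A (`exists_patternFree_even_design_pencil`, p747329)
carries the hypothesis `hdim : finrank W_ev(δ) = 2τ`. This file PROVES the parity and removes `hdim`: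
* ★ `odd_finrank_ker_of_isSymm_of_diag` — a symmetric matrix `S` over `𝔽₂` on an index set of even size whose diagonal is `S e₀` with
  `e₀ᵀ S e₀ = 1` has `dim ker S` odd: `S + δδᵀ` (`δ = S e₀`) is symmetric with zero diagonal, hence of even rank by Godsil–Royle Thm 8.10.1
  (tree theorem `Literature.Combinatorics.SimpleGraph.BinaryRankEven.rank_even_of_isSymm_of_diag_eq_zero`), and `ker (S + δδᵀ) = ker S ⊕ ⟨e₀⟩`;
* ★★ `odd_finrank_evenVirtualKernel` — for every base with `Σ_b [P_b ≡ 3 (4)] = 1` in `𝔽₂`, `finrank 𝒦_ev` is odd: in the coordinates `(u; u+v)`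
  the even virtual kernel is `ker Ŝ`, `Ŝ = [[D_d, A],[Aᵀ, D_m]]` with `A = L + D_d` (`Aᵀ` written out by quadratic reciprocity `bz_neg_swap`),
  `diag Ŝ = (d; m) = Ŝ(0;1)` and `(0;1)ᵀ Ŝ (0;1) = μ = 1`;
* ★ `finrank_evenPencil_eq` — a legitimate even pencil has `finrank W_ev(δ) = finrank 𝒦_ev + 1`;
* ★★ `exists_patternFree_even_design_pencil_of_odd` — EVEN THEOREM A at `τ := (finrank 𝒦_ev + 1)/2` with `hdim` DISCHARGED.

HONEST FRAMING: RUNG-LEVEL corner layer (even congruent `j = 1728` families `E_{2n₀}`); linear algebra over `𝔽₂` attached to Monsky matrices; the crux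
as stated (C⁺), its registered stubs and BSD are NOT touched; nothing is closed. THEOREMS ONLY (no `def`, no instance, no notation).
References: [HeathBrown1994] D. R. Heath-Brown, Invent. Math. 118 (1994) 331–370, appendix (Monsky), typescript p. 41 L20–L36;
[GodsilRoyle2001] C. Godsil, G. Royle, Algebraic Graph Theory, GTM 207, Thm 8.10.1.
-/

namespace Summit.BirchSwinnertonDyer.BirchSwinnertonDyer.Theorems.SymbolicMonsky

section KernelParity

open Module Matrix

/-- ★ **Parity lemma (general).** Let `S` be a symmetric matrix over `𝔽₂` whose diagonal is the vector `S e₀` for some `e₀` with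
`e₀ᵀ S e₀ = 1` (a characteristic vector of odd norm), on an index set of even size. Then `dim ker S` is ODD. Proof: `S + δδᵀ` (`δ = S e₀`)
is symmetric with zero diagonal, hence of even rank [cite: GodsilRoyle2001, Thm 8.10.1] (tree `rank_even_of_isSymm_of_diag_eq_zero`), and
`ker (S + δδᵀ) = ker S ⊕ ⟨e₀⟩`. -/
theorem odd_finrank_ker_of_isSymm_of_diag {n : Type*} [Fintype n] [DecidableEq n] (S : Matrix n n (ZMod 2)) (hS : S.IsSymm)
    (e₀ : n → ZMod 2) (hdiag : ∀ i, S i i = (S *ᵥ e₀) i) (hodd : e₀ ⬝ᵥ (S *ᵥ e₀) = 1) (heven : Even (Fintype.card n)) :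
    Odd (finrank (ZMod 2) ↥(LinearMap.ker S.mulVecLin)) := by
  have h2 : ∀ x : ZMod 2, x + x = 0 := by decide
  have hsq : ∀ x : ZMod 2, x * x = x := by decide
  set δ : n → ZMod 2 := S *ᵥ e₀ with hδ
  set S' : Matrix n n (ZMod 2) := S + vecMulVec δ δ with hS'
  -- `S'` is alternating
  have hS'symm : S'.IsSymm := by
    rw [hS']
    exact hS.add (show (vecMulVec δ δ)ᵀ = vecMulVec δ δ from transpose_vecMulVec δ δ)
  have hS'diag : ∀ i, S' i i = 0 := by
    intro i
    rw [hS', Matrix.add_apply, vecMulVec_apply, hdiag i, hsq]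
    exact h2 _
  have hrank : Even S'.rank :=
    Literature.Combinatorics.SimpleGraph.BinaryRankEven.rank_even_of_isSymm_of_diag_eq_zero hS'symm hS'diag
  -- action of `S'`
  have hS'mul : ∀ z, S' *ᵥ z = S *ᵥ z + (δ ⬝ᵥ z) • δ := by
    intro z
    rw [hS', add_mulVec, vecMulVec_mulVec, op_smul_eq_smul]
  -- `δ ⬝ z = e₀ ⬝ S z` (symmetry)
  have hδz : ∀ z, δ ⬝ᵥ z = e₀ ⬝ᵥ (S *ᵥ z) := by
    intro z
    rw [hδ, dotProduct_mulVec, ← mulVec_transpose, hS.eq]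
  have hδ0 : δ ≠ 0 := by
    intro h
    rw [h, dotProduct_zero] at hodd
    exact zero_ne_one hodd
  have he₀δ : δ ⬝ᵥ e₀ = 1 := by rw [dotProduct_comm]; exact hodd
  -- kernel of `S'`
  have hker : LinearMap.ker S'.mulVecLin = LinearMap.ker S.mulVecLin ⊔ Submodule.span (ZMod 2) {e₀} := by
    apply le_antisymm
    · intro z hz
      rw [LinearMap.mem_ker, mulVecLin_apply, hS'mul] at hz
      rw [Submodule.mem_sup]
      refine ⟨z - (δ ⬝ᵥ z) • e₀, ?_, (δ ⬝ᵥ z) • e₀, Submodule.mem_span_singleton.2 ⟨_, rfl⟩, by abel⟩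
      rw [LinearMap.mem_ker, mulVecLin_apply, mulVec_sub, mulVec_smul]
      funext i
      have hzi := congrFun hz i
      simp only [Pi.add_apply, Pi.smul_apply, smul_eq_mul, Pi.zero_apply] at hzi
      simp only [Pi.sub_apply, Pi.smul_apply, smul_eq_mul, Pi.zero_apply]
      linear_combination hzi - h2 ((δ ⬝ᵥ z) * δ i)
    · refine sup_le (fun z hz => ?_) ?_
      · rw [LinearMap.mem_ker, mulVecLin_apply] at hz ⊢
        rw [hS'mul, hz, hδz, hz, dotProduct_zero, zero_smul, add_zero]
      · rw [Submodule.span_le, Set.singleton_subset_iff, SetLike.mem_coe, LinearMap.mem_ker, mulVecLin_apply, hS'mul, he₀δ,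
          one_smul, ← hδ]
        funext i
        exact h2 _
  have hdisj : LinearMap.ker S.mulVecLin ⊓ Submodule.span (ZMod 2) {e₀} = ⊥ := by
    rw [Submodule.eq_bot_iff]
    intro z hz
    obtain ⟨hz1, hz2⟩ := Submodule.mem_inf.1 hz
    obtain ⟨c, rfl⟩ := Submodule.mem_span_singleton.1 hz2
    rw [LinearMap.mem_ker, mulVecLin_apply, mulVec_smul, ← hδ] at hz1
    rcases smul_eq_zero.1 hz1 with hc | hc
    · rw [hc, zero_smul]
    · exact absurd hc hδ0
  have he₀0 : e₀ ≠ 0 := by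
    intro h
    rw [h, zero_dotProduct] at hodd
    exact zero_ne_one hodd
  have hfin : finrank (ZMod 2) ↥(LinearMap.ker S'.mulVecLin) = finrank (ZMod 2) ↥(LinearMap.ker S.mulVecLin) + 1 := by
    have h := Submodule.finrank_sup_add_finrank_inf_eq (LinearMap.ker S.mulVecLin) (Submodule.span (ZMod 2) {e₀})
    rw [hdisj, finrank_bot, add_zero, finrank_span_singleton he₀0, ← hker] at h
    exact h
  -- rank–nullity for `S'`
  have hrn := LinearMap.finrank_range_add_finrank_ker S'.mulVecLin
  rw [Module.finrank_fintype_fun_eq_card, hfin] at hrn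
  change S'.rank + _ = _ at hrn
  obtain ⟨r, hr⟩ := hrank
  obtain ⟨c, hc⟩ := heven
  exact ⟨c - r - 1, by omega⟩

variable {k : ℕ} (base : SymbData (k + 1))

/-- Row of the block `A = L + D_d`: `(A w)_i = Σ_j [(P_j/P_i) = −1](w_j + w_i) + [(2/P_i) = −1] w_i`. -/
private theorem aBlock_mulVec (w : Fin (k + 1) → ZMod 2) (i : Fin (k + 1)) :
    ((Matrix.of fun i j : Fin (k + 1) => bz (base.neg i j) +
        if i = j then (∑ l, bz (base.neg i l)) + bz (negTwo (base.cls i)) else 0) *ᵥ w) i =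
      (∑ j, bz (base.neg i j) * (w j + w i)) + bz (negTwo (base.cls i)) * w i := by
  simp only [mulVec, dotProduct, Matrix.of_apply]
  have e1 : (∑ j, (bz (base.neg i j) + if i = j then (∑ l, bz (base.neg i l)) + bz (negTwo (base.cls i)) else 0) * w j) =
      (∑ j, bz (base.neg i j) * w j) + ∑ j, (if i = j then ((∑ l, bz (base.neg i l)) + bz (negTwo (base.cls i))) * w j else 0) := by
    rw [← Finset.sum_add_distrib]
    refine Finset.sum_congr rfl fun j _ => ?_
    split_ifs <;> ring
  have e2 : (∑ j, bz (base.neg i j) * (w j + w i)) = (∑ j, bz (base.neg i j) * w j) + (∑ l, bz (base.neg i l)) * w i := by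
    rw [Finset.sum_mul, ← Finset.sum_add_distrib]
    exact Finset.sum_congr rfl fun j _ => by ring
  rw [e1, Finset.sum_ite_eq, e2]
  simp only [Finset.mem_univ, if_true]
  ring

/-- Row of the block `B = Aᵀ` (written out by quadratic reciprocity):
`(B u)_i = Σ_j [(P_j/P_i) = −1](u_j + u_i) + m_i ⟨m,u⟩ + m_i u_i + d_i u_i`. -/
private theorem bBlock_mulVec (u : Fin (k + 1) → ZMod 2) (i : Fin (k + 1)) :
    ((Matrix.of fun i j : Fin (k + 1) => bz (base.neg i j) + bz (negNegOne (base.cls i)) * bz (negNegOne (base.cls j)) +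
        if i = j then (∑ l, bz (base.neg i l)) + bz (negNegOne (base.cls i)) + bz (negTwo (base.cls i)) else 0) *ᵥ u) i =
      (∑ j, bz (base.neg i j) * (u j + u i)) + bz (negNegOne (base.cls i)) * (∑ j, bz (negNegOne (base.cls j)) * u j) +
        bz (negNegOne (base.cls i)) * u i + bz (negTwo (base.cls i)) * u i := by
  simp only [mulVec, dotProduct, Matrix.of_apply]
  have e1 : (∑ j, (bz (base.neg i j) + bz (negNegOne (base.cls i)) * bz (negNegOne (base.cls j)) +
      if i = j then (∑ l, bz (base.neg i l)) + bz (negNegOne (base.cls i)) + bz (negTwo (base.cls i)) else 0) * u j) =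
      (∑ j, bz (base.neg i j) * u j) + bz (negNegOne (base.cls i)) * (∑ j, bz (negNegOne (base.cls j)) * u j) +
        ∑ j, (if i = j then ((∑ l, bz (base.neg i l)) + bz (negNegOne (base.cls i)) + bz (negTwo (base.cls i))) * u j else 0) := by
    rw [Finset.mul_sum, ← Finset.sum_add_distrib, ← Finset.sum_add_distrib]
    refine Finset.sum_congr rfl fun j _ => ?_
    split_ifs <;> ring
  have e2 : (∑ j, bz (base.neg i j) * (u j + u i)) = (∑ j, bz (base.neg i j) * u j) + (∑ l, bz (base.neg i l)) * u i := by
    rw [Finset.sum_mul, ← Finset.sum_add_distrib]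
    exact Finset.sum_congr rfl fun j _ => by ring
  rw [e1, Finset.sum_ite_eq, e2]
  simp only [Finset.mem_univ, if_true]
  ring

/-- The two blocks are transposes of each other (quadratic reciprocity `bz_neg_swap`). -/
private theorem aBlock_transpose :
    (Matrix.of fun i j : Fin (k + 1) => bz (base.neg i j) +
        if i = j then (∑ l, bz (base.neg i l)) + bz (negTwo (base.cls i)) else 0)ᵀ =
      (Matrix.of fun i j : Fin (k + 1) => bz (base.neg i j) + bz (negNegOne (base.cls i)) * bz (negNegOne (base.cls j)) +
        if i = j then (∑ l, bz (base.neg i l)) + bz (negNegOne (base.cls i)) + bz (negTwo (base.cls i)) else 0) := by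
  have h2 : ∀ x : ZMod 2, x + x = 0 := by decide
  have hsq : ∀ x : ZMod 2, x * x = x := by decide
  ext i j
  simp only [transpose_apply, Matrix.of_apply]
  by_cases hij : i = j
  · subst hij
    simp only [if_true]
    linear_combination (hsq (bz (negNegOne (base.cls i)))).symm - h2 (bz (negNegOne (base.cls i)))
  · have hji : j ≠ i := fun h => hij h.symm
    rw [if_neg hji, if_neg hij, base.bz_neg_swap hij, bz_and_mul, Bool.and_comm]

/-- ★★ **KERNEL PARITY.** For every base datum with an ODD number of primes `≡ 3 (mod 4)` (`Σ_b [P_b ≡ 3 (4)] = 1` in `𝔽₂` — the even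
root-number-`−1` bases `E_{2·P₀⋯P_k}`) the even virtual kernel `𝒦_ev` has ODD dimension `s_ev`; so `τ₀^{ev} := (s_ev + 1)/2` is an integer and
a legitimate even pencil `W_ev(δ) = T_δ(𝒦_ev) ⊕ ⟨(δ,1+δ)⟩` has even dimension `2τ₀^{ev}` (hypothesis `hdim` of EVEN THEOREM A). Proof: in the
coordinates `(u; u+v)` the kernel is `ker Ŝ` for the symmetric matrix `Ŝ = [[D_d, A],[Aᵀ, D_m]]` whose diagonal `(d; m)` is `Ŝ e₀`,
`e₀ = (0; 1)`, with `e₀ᵀ Ŝ e₀ = μ = 1`; apply `odd_finrank_ker_of_isSymm_of_diag`.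
[cite: HeathBrown1994SelmerCongruentII, Appendix (Monsky), typescript p. 41 L20–L36] -/
theorem odd_finrank_evenVirtualKernel (hμ : (∑ b, bz (negNegOne (base.cls b))) = 1) :
    Odd (finrank (ZMod 2) ↥base.evenVirtualKernel) := by
  have h2 : ∀ x : ZMod 2, x + x = 0 := by decide
  -- the blocks
  set dv : Fin (k + 1) → ZMod 2 := fun i => bz (negTwo (base.cls i)) with hdv
  set mv : Fin (k + 1) → ZMod 2 := fun i => bz (negNegOne (base.cls i)) with hmv
  set A : Matrix (Fin (k + 1)) (Fin (k + 1)) (ZMod 2) := Matrix.of fun i j : Fin (k + 1) => bz (base.neg i j) +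
      if i = j then (∑ l, bz (base.neg i l)) + bz (negTwo (base.cls i)) else 0 with hA
  set B : Matrix (Fin (k + 1)) (Fin (k + 1)) (ZMod 2) := Matrix.of fun i j : Fin (k + 1) => bz (base.neg i j) +
      bz (negNegOne (base.cls i)) * bz (negNegOne (base.cls j)) +
      if i = j then (∑ l, bz (base.neg i l)) + bz (negNegOne (base.cls i)) + bz (negTwo (base.cls i)) else 0 with hB
  have hAT : Aᵀ = B := aBlock_transpose base
  set S : Matrix (Fin (k + 1) ⊕ Fin (k + 1)) (Fin (k + 1) ⊕ Fin (k + 1)) (ZMod 2) :=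
    Matrix.fromBlocks (diagonal dv) A B (diagonal mv) with hS
  have hSsymm : S.IsSymm := Matrix.IsSymm.fromBlocks (isSymm_diagonal _) hAT (isSymm_diagonal _)
  set e₀ : Fin (k + 1) ⊕ Fin (k + 1) → ZMod 2 := Sum.elim (0 : Fin (k + 1) → ZMod 2) (1 : Fin (k + 1) → ZMod 2) with he₀
  -- `S` on a block vector
  have hSmul : ∀ u w : Fin (k + 1) → ZMod 2, S *ᵥ Sum.elim u w = Sum.elim (diagonal dv *ᵥ u + A *ᵥ w) (B *ᵥ u + diagonal mv *ᵥ w) := by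
    intro u w
    rw [hS, fromBlocks_mulVec]
    rfl
  have hA1 : ∀ i, (A *ᵥ (1 : Fin (k + 1) → ZMod 2)) i = dv i := by
    intro i
    rw [aBlock_mulVec]
    simp [h2, hdv]
  have hdiag : ∀ i, S i i = (S *ᵥ e₀) i := by
    have he : e₀ = Sum.elim (0 : Fin (k + 1) → ZMod 2) (1 : Fin (k + 1) → ZMod 2) := rfl
    intro i
    rw [he, hSmul]
    rcases i with a | a
    · simp only [Sum.elim_inl, mulVec_zero, zero_add, hA1]
      rw [hS, fromBlocks_apply₁₁, diagonal_apply_eq]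
    · simp only [Sum.elim_inr, mulVec_zero, zero_add, mulVec_diagonal, Pi.one_apply, mul_one]
      rw [hS, fromBlocks_apply₂₂, diagonal_apply_eq]
  have hodd : e₀ ⬝ᵥ (S *ᵥ e₀) = 1 := by
    have he : e₀ = Sum.elim (0 : Fin (k + 1) → ZMod 2) (1 : Fin (k + 1) → ZMod 2) := rfl
    rw [he, hSmul, dotProduct]
    rw [Fintype.sum_sum_type]
    simp only [Sum.elim_inl, Sum.elim_inr, Pi.zero_apply, zero_mul, Finset.sum_const_zero, zero_add, Pi.one_apply, one_mul,
      mulVec_zero, mulVec_diagonal, mul_one]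
    rw [← hμ]
  have heven : Even (Fintype.card (Fin (k + 1) ⊕ Fin (k + 1))) := ⟨k + 1, by simp⟩
  have hpar := odd_finrank_ker_of_isSymm_of_diag S hSsymm e₀ hdiag hodd heven
  -- the shear `(u, v) ↦ (u; u + v)` identifies `𝒦_ev` with `ker S`
  let Ψ : ((Fin (k + 1) → ZMod 2) × (Fin (k + 1) → ZMod 2)) →ₗ[ZMod 2] (Fin (k + 1) ⊕ Fin (k + 1) → ZMod 2) :=
    { toFun := fun p => Sum.elim p.1 (p.1 + p.2)
      map_add' := by
        intro p q
        funext i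
        rcases i with a | a <;> simp [add_comm, add_left_comm, add_assoc]
      map_smul' := by
        intro c p
        funext i
        rcases i with a | a <;> simp [mul_add] }
  have hΨ : ∀ p, Ψ p = Sum.elim p.1 (p.1 + p.2) := fun p => rfl
  have hΨinj : Function.Injective Ψ := by
    intro p q hpq
    rw [hΨ, hΨ] at hpq
    have h1 : p.1 = q.1 := by
      funext a; exact congrFun hpq (Sum.inl a)
    refine Prod.ext h1 ?_
    funext a
    have := congrFun hpq (Sum.inr a)
    simp only [Sum.elim_inr, Pi.add_apply] at this
    rw [h1] at this
    exact add_left_cancel this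
  -- membership
  have hmem : ∀ p : (Fin (k + 1) → ZMod 2) × (Fin (k + 1) → ZMod 2),
      p ∈ base.evenVirtualKernel ↔ S *ᵥ Ψ p = 0 := by
    intro p
    rw [mem_evenVirtualKernel_iff, hΨ, hSmul]
    have hrow1 : ∀ i, (diagonal dv *ᵥ p.1 + A *ᵥ (p.1 + p.2)) i =
        bz (negTwo (base.cls i)) * p.1 i + (∑ j, bz (base.neg i j) * ((p.1 j + p.2 j) + (p.1 i + p.2 i))) +
          bz (negTwo (base.cls i)) * (p.1 i + p.2 i) := by
      intro i
      rw [Pi.add_apply, mulVec_diagonal, aBlock_mulVec]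
      simp only [hdv, Pi.add_apply]
      ring
    have hrow2 : ∀ i, (B *ᵥ p.1 + diagonal mv *ᵥ (p.1 + p.2)) i =
        (∑ j, bz (base.neg i j) * (p.1 j + p.1 i)) + bz (negNegOne (base.cls i)) * (∑ j, bz (negNegOne (base.cls j)) * p.1 j) +
          bz (negNegOne (base.cls i)) * p.1 i + bz (negTwo (base.cls i)) * p.1 i + bz (negNegOne (base.cls i)) * (p.1 i + p.2 i) := by
      intro i
      rw [Pi.add_apply, mulVec_diagonal, bBlock_mulVec]
      simp only [hmv, Pi.add_apply]
    have hsplit : ∀ i, (∑ j, bz (base.neg i j) * ((p.1 j + p.2 j) + (p.1 i + p.2 i))) =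
        (∑ j, bz (base.neg i j) * (p.1 j + p.1 i)) + ∑ j, bz (base.neg i j) * (p.2 j + p.2 i) := by
      intro i
      rw [← Finset.sum_add_distrib]
      exact Finset.sum_congr rfl fun j _ => by ring
    constructor
    · rintro ⟨hE1, hE2⟩
      funext i
      rcases i with a | a
      · rw [Sum.elim_inl, hrow1, hsplit, Pi.zero_apply]
        have e1 := hE1 a
        have e2 := hE2 a
        linear_combination e1 + e2 - h2 (bz (negNegOne (base.cls a)) * (∑ j, bz (negNegOne (base.cls j)) * p.1 j)) -
          h2 (bz (negNegOne (base.cls a)) * p.2 a)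
      · rw [Sum.elim_inr, hrow2, Pi.zero_apply]
        have e1 := hE1 a
        linear_combination e1 + h2 (bz (negNegOne (base.cls a)) * p.1 a)
    · intro h
      have r1 : ∀ a, (diagonal dv *ᵥ p.1 + A *ᵥ (p.1 + p.2)) a = 0 := fun a => by
        have := congrFun h (Sum.inl a); rwa [Sum.elim_inl] at this
      have r2 : ∀ a, (B *ᵥ p.1 + diagonal mv *ᵥ (p.1 + p.2)) a = 0 := fun a => by
        have := congrFun h (Sum.inr a); rwa [Sum.elim_inr] at this
      refine ⟨fun a => ?_, fun a => ?_⟩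
      · have e := r2 a
        rw [hrow2] at e
        linear_combination e - h2 (bz (negNegOne (base.cls a)) * p.1 a)
      · have e := r1 a
        have e' := r2 a
        rw [hrow1, hsplit] at e
        rw [hrow2] at e'
        linear_combination e + e' - h2 (bz (negTwo (base.cls a)) * p.1 a) - h2 (bz (negNegOne (base.cls a)) * p.1 a) -
          h2 (∑ j, bz (base.neg a j) * (p.1 j + p.1 a))
  -- transport the dimension
  have hmap : base.evenVirtualKernel.map Ψ = LinearMap.ker S.mulVecLin := by
    apply le_antisymm
    · intro z hz
      obtain ⟨p, hp, rfl⟩ := Submodule.mem_map.1 hz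
      rw [hmem] at hp
      rw [LinearMap.mem_ker, mulVecLin_apply]
      exact hp
    · intro z hz
      rw [LinearMap.mem_ker, mulVecLin_apply] at hz
      have hz' : Ψ (z ∘ Sum.inl, z ∘ Sum.inl + z ∘ Sum.inr) = z := by
        rw [hΨ]
        funext i
        rcases i with a | a
        · simp
        · simp only [Sum.elim_inr, Pi.add_apply, Function.comp_apply]
          rw [← add_assoc, h2, zero_add]
      refine Submodule.mem_map.2 ⟨(z ∘ Sum.inl, z ∘ Sum.inl + z ∘ Sum.inr), ?_, hz'⟩
      rw [hmem, hz']
      exact hz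
  rw [LinearEquiv.finrank_eq (Submodule.equivMapOfInjective Ψ hΨinj base.evenVirtualKernel), hmap]
  exact hpar

/-- ★ **Dimension of a legitimate even pencil.** If `(δ, 1+δ) ∉ T_δ(𝒦_ev)` then `finrank W_ev(δ) = finrank 𝒦_ev + 1` (`T_δ` is injective,
`evenTwist_injective`, and the extra line is transversal). -/
theorem finrank_evenPencil_eq (δ : Fin (k + 1) → ZMod 2)
    (hδ : ((δ, fun i => 1 + δ i) : (Fin (k + 1) → ZMod 2) × (Fin (k + 1) → ZMod 2)) ∉
      base.evenVirtualKernel.map (base.evenTwist δ)) :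
    finrank (ZMod 2) ↥(base.evenPencil δ) = finrank (ZMod 2) ↥base.evenVirtualKernel + 1 := by
  unfold SymbData.evenPencil
  set M := base.evenVirtualKernel.map (base.evenTwist δ) with hM
  set w : (Fin (k + 1) → ZMod 2) × (Fin (k + 1) → ZMod 2) := (δ, fun i => 1 + δ i) with hw
  have hw0 : w ≠ 0 := by
    intro h
    have h1 : (fun i => 1 + δ i) = (0 : Fin (k + 1) → ZMod 2) := congrArg Prod.snd h
    have h0 : δ = 0 := congrArg Prod.fst h
    have := congrFun h1 0
    rw [h0] at this
    simp at this
  have hdis : M ⊓ Submodule.span (ZMod 2) {w} = ⊥ :=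
    disjoint_iff.1 ((Submodule.disjoint_span_singleton).2 fun h => absurd h hδ)
  have h := Submodule.finrank_sup_add_finrank_inf_eq M (Submodule.span (ZMod 2) {w})
  rw [hdis, finrank_bot, add_zero, finrank_span_singleton hw0,
    ← LinearEquiv.finrank_eq (Submodule.equivMapOfInjective _ (evenTwist_injective base δ) base.evenVirtualKernel)] at h
  exact h

/-- ★★ **EVEN THEOREM A without the dimension hypothesis.** For an even root-number-`−1` base (`Σ_b [P_b ≡ 3 (4)] = 1` in `𝔽₂`) and a
legitimate `δ`, put `τ := (finrank 𝒦_ev + 1)/2` (an integer by `odd_finrank_evenVirtualKernel`; then `finrank W_ev(δ) = 2τ` automatically by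
`finrank_evenPencil_eq`): if `W_ev(δ)` meets `V × 0`, `0 × V` and the diagonal in dimension `≤ τ`, a pattern-free Heegner recipe with `τ + 1`
auxiliary primes exists on `E_{2·P₀⋯P_k}`. (EVEN THEOREM A = `exists_patternFree_even_design_pencil` with `hdim` discharged by the kernel parity.)
[cite: HeathBrown1994SelmerCongruentII, Appendix (Monsky), typescript p. 41 L20–L36] -/
theorem exists_patternFree_even_design_pencil_of_odd (hμ : (∑ b, bz (negNegOne (base.cls b))) = 1) (δ : Fin (k + 1) → ZMod 2)
    (hδ : ((δ, fun i => 1 + δ i) : (Fin (k + 1) → ZMod 2) × (Fin (k + 1) → ZMod 2)) ∉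
      base.evenVirtualKernel.map (base.evenTwist δ))
    (h1 : finrank (ZMod 2) ↥(base.evenPencil δ ⊓
      LinearMap.ker (LinearMap.snd (ZMod 2) (Fin (k + 1) → ZMod 2) (Fin (k + 1) → ZMod 2))) ≤
        (finrank (ZMod 2) ↥base.evenVirtualKernel + 1) / 2)
    (h2 : finrank (ZMod 2) ↥(base.evenPencil δ ⊓
      LinearMap.ker (LinearMap.fst (ZMod 2) (Fin (k + 1) → ZMod 2) (Fin (k + 1) → ZMod 2))) ≤
        (finrank (ZMod 2) ↥base.evenVirtualKernel + 1) / 2)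
    (h3 : finrank (ZMod 2) ↥(base.evenPencil δ ⊓ LinearMap.ker (LinearMap.fst (ZMod 2) (Fin (k + 1) → ZMod 2) (Fin (k + 1) → ZMod 2) +
      LinearMap.snd (ZMod 2) (Fin (k + 1) → ZMod 2) (Fin (k + 1) → ZMod 2))) ≤
        (finrank (ZMod 2) ↥base.evenVirtualKernel + 1) / 2) :
    ∃ (c₁ : AuxCell) (rest : List AuxCell), rest.length = (finrank (ZMod 2) ↥base.evenVirtualKernel + 1) / 2 ∧
      heegnerK base (c₁ :: rest) = true ∧ ∀ pat : ℕ → ℕ → Bool, (dataK base (c₁ :: rest) pat).monskyEvenS.det = 1 := by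
  obtain ⟨r, hr⟩ := odd_finrank_evenVirtualKernel base hμ
  have hτ : (finrank (ZMod 2) ↥base.evenVirtualKernel + 1) / 2 = r + 1 := by omega
  rw [hτ] at h1 h2 h3 ⊢
  have hdim : finrank (ZMod 2) ↥(base.evenPencil δ) = 2 * (r + 1) := by
    rw [finrank_evenPencil_eq base δ hδ, hr]; ring
  exact exists_patternFree_even_design_pencil base δ (r + 1) hδ hdim h1 h2 h3

end KernelParity

end Summit.BirchSwinnertonDyer.BirchSwinnertonDyer.Theorems.SymbolicMonsky
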